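import Literature.NumberTheory.Automorphic.UnitaryGroupSymplecticCarriers
import Mathlib.GroupTheory.NoncommCoprod
import HarnessLib

/-!
# The unitary dual pair on its carriers: `U(J_V) × U(J_W) ⇉ G₁ = U(J_V ⊗ J_W) → Sp(𝕎)`, continuity,
rational points (the `GA`, `a`, `b`, `toSp`, `ratPts` of a dual-pair splitting datum)

Topic `NumberTheory/Automorphic`; namespace `Literature.NumberTheory.Automorphic.UnitaryGroup` (third part of
`UnitaryGroupSymplecticEmbedding`). Definitions and proved lemmas only: **no named facts, 0 proof holes**.

Gelbart–Rogawski [GelbartRogawski1991, §3.1–§3.2] restrict ONE splitting `s : G₁(𝐀) → Mp_𝐀(𝕎)` of the big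
unitary group `G₁ = U(V ⊗ V′)` of a dual pair along the two commuting inclusions `U(V)(𝐀) → G₁(𝐀) ← U(V′)(𝐀)`.
The abstract datum over which Prop. 3.1.1 is recorded (`GelbartRogawski1991/CompatibleSplitting.lean`:
`SplittingDatum.toSp : GA →* Sp`, `ratPts`, and `IsCompatible.pair (a : GU →* GA) (b : G →* GA) (hab : Commute)`,
`continuous_pair (hac : Continuous a) (hbc : Continuous b)`) needs, from the group side, exactly:

* §1 (generic, any commutative topological ring `S`): `continuous_kronecker`, **`continuous_kroneckerGL`**,
  **`continuous_dualPair`**; the two inclusions `dualPairInl σ H_V H_W : U(σ,H_V) →* U(σ, H_V ⊗ₖ H_W)` (`g ↦ g ⊗ 1`),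
  `dualPairInr` (`g′ ↦ 1 ⊗ g′`), `commute_dualPairInl_dualPairInr`,
  `noncommCoprod_dualPairInl_dualPairInr = dualPair`, `continuous_dualPairInl/Inr`; functoriality in the ring
  `coe_map_dualPair` (`(g ⊗ g′) ⊗ 1 = (g ⊗ 1) ⊗ (g′ ⊗ 1)`); and the generic
  **`IsQuadraticCoordinates.pairToSymplectic : U(σ, H_V ⊗ₖ H_W) →* Sp(alt (polar β_{T_V ⊗ T_W}))`** with
  `pairToSymplectic ∘ dualPair = dualPairToSymplectic` (`rfl`).
* §2 (number fields, `J_V = T_V ⊗ 1`, `J_W = T_W ⊗ 1`, `T`'s symmetric over `F`): the ADELIC big group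
  **`adelicPair F E c N M J_V J_W = U(J_V ⊗ J_W)(𝔸_F) ≤ GL_{N M}(𝔸_E)`** (index `Fin N × Fin M`), the inclusions
  **`adelicInl : adelic F E c N J_V →* adelicPair …`**, **`adelicInr`** (continuous, commuting,
  `noncommCoprod_adelicInl_adelicInr`), **`adelicPairToSymplectic … : adelicPair … →* symplecticGroup (polar
  (Matrix.toLinearMap₂' 𝔸_F (T_V ⊗ 1 ⊗ₖ T_W ⊗ 1)))`** with `adelicPairToSymplectic ∘ dualPair =
  adelicDualPairToSymplectic` (`rfl`); the RATIONAL big group `rationalPair F E c N M J_V J_W = U(J_V ⊗ J_W)(F)`,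
  its diagonal embedding **`rationalPairToAdelic : rationalPair … →* adelicPair …`** (injective), `rationalInl/Inr`,
  and the compatibilities `adelicInl_toAdelic : adelicInl (toAdelic γ) = rationalPairToAdelic (rationalInl γ)` (hence
  `adelicInl (toAdelic γ) ∈ range rationalPairToAdelic` = the hypothesis `ha` of `IsCompatible.pair`), same for `Inr`;
  **`adelicPairToSymplectic_rationalPairToAdelic_apply`**: the `F`-RATIONAL block formula of `toSp(γ)`, `γ ∈ G₁(F)`
  (the datum's `toSp_mem_spRat`).

## References
* [GelbartRogawski1991] S. Gelbart, J. Rogawski, *L-functions and Fourier–Jacobi coefficients for the unitary group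
  U(3)*, Invent. Math. 105 (1991), §3.1 p. 454 (the datum), §3.2 (restriction to the dual pair).
* [MoeglinVignerasWaldspurger1987] C. Mœglin, M.-F. Vignéras, J.-L. Waldspurger, LNM 1291, Ch. 1 I.17–I.19 (dual pairs).
-/

set_option autoImplicit false

noncomputable section

open Matrix NumberField IsDedekindDomain
open scoped Kronecker
open Literature.RepresentationTheory.HeisenbergGroup

namespace Literature.NumberTheory.Automorphic

namespace UnitaryGroup

/-! ## 1. Generic: continuity of `g ⊗ g′`, the two inclusions, the big group into `Sp` -/

section Generic

variable {R S : Type*} [CommRing R] [CommRing S] {n m : Type*} [Fintype n] [DecidableEq n] [Fintype m]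
  [DecidableEq m]

omit [Fintype n] [DecidableEq n] [Fintype m] [DecidableEq m] in
/-- `(A, B) ↦ A ⊗ₖ B` is continuous (entries are products of entries). [folklore] -/
theorem continuous_kronecker [TopologicalSpace S] [IsTopologicalRing S] :
    Continuous fun p : Matrix n n S × Matrix m m S => p.1 ⊗ₖ p.2 :=
  continuous_matrix fun i j =>
    ((Continuous.matrix_elem (A := fun p : Matrix n n S × Matrix m m S => p.1) continuous_fst i.1 j.1).mul
      (Continuous.matrix_elem (A := fun p : Matrix n n S × Matrix m m S => p.2) continuous_snd i.2 j.2) :)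

/-- **`(g, g′) ↦ g ⊗ₖ g′ : GLₙ × GLₘ → GL_{n m}` is continuous** for the unit-group topologies. [folklore] -/
theorem continuous_kroneckerGL [TopologicalSpace S] [IsTopologicalRing S] :
    Continuous (kroneckerGL : GL n S × GL m S → GL (n × m) S) := by
  refine Units.continuous_iff.2 ⟨?_, ?_⟩
  · exact continuous_kronecker.comp
      ((Units.continuous_val.comp continuous_fst).prodMk (Units.continuous_val.comp continuous_snd))
  · exact continuous_kronecker.comp
      ((Units.continuous_coe_inv.comp continuous_fst).prodMk (Units.continuous_coe_inv.comp continuous_snd))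

/-- **the dual pair map `(g, g′) ↦ g ⊗ g′` is continuous.** [folklore] -/
theorem continuous_dualPair [TopologicalSpace S] [IsTopologicalRing S] (σ : S →+* S) (HV : Matrix n n S)
    (HW : Matrix m m S) : Continuous (dualPair σ HV HW) :=
  Continuous.subtype_mk (continuous_kroneckerGL.comp
    (continuous_subtype_val.prodMap continuous_subtype_val)) _

/-- **`a : U(σ, H_V) →* U(σ, H_V ⊗ₖ H_W)`, `g ↦ g ⊗ 1`.** [cite: MoeglinVignerasWaldspurger1987, Ch. 1 I.17] -/
def dualPairInl (σ : S →+* S) (HV : Matrix n n S) (HW : Matrix m m S) :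
    unitaryGroupOfForm σ HV →* unitaryGroupOfForm σ (HV ⊗ₖ HW) :=
  (dualPair σ HV HW).comp (MonoidHom.inl _ _)

/-- **`b : U(σ, H_W) →* U(σ, H_V ⊗ₖ H_W)`, `g′ ↦ 1 ⊗ g′`.** [cite: MoeglinVignerasWaldspurger1987, Ch. 1 I.17] -/
def dualPairInr (σ : S →+* S) (HV : Matrix n n S) (HW : Matrix m m S) :
    unitaryGroupOfForm σ HW →* unitaryGroupOfForm σ (HV ⊗ₖ HW) :=
  (dualPair σ HV HW).comp (MonoidHom.inr _ _)

/-- formula. [folklore] -/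
@[simp] theorem dualPairInl_apply (σ : S →+* S) (HV : Matrix n n S) (HW : Matrix m m S)
    (g : unitaryGroupOfForm σ HV) : dualPairInl σ HV HW g = dualPair σ HV HW (g, 1) := rfl

/-- formula. [folklore] -/
@[simp] theorem dualPairInr_apply (σ : S →+* S) (HV : Matrix n n S) (HW : Matrix m m S)
    (g' : unitaryGroupOfForm σ HW) : dualPairInr σ HV HW g' = dualPair σ HV HW (1, g') := rfl

/-- **the two inclusions commute.** [folklore] -/
theorem commute_dualPairInl_dualPairInr (σ : S →+* S) (HV : Matrix n n S) (HW : Matrix m m S)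
    (g : unitaryGroupOfForm σ HV) (g' : unitaryGroupOfForm σ HW) :
    Commute (dualPairInl σ HV HW g) (dualPairInr σ HV HW g') :=
  dualPair_commute σ HV HW g g'

/-- `(g, g′) ↦ a(g) b(g′)` IS the dual pair map. [folklore] -/
theorem noncommCoprod_dualPairInl_dualPairInr (σ : S →+* S) (HV : Matrix n n S) (HW : Matrix m m S) :
    MonoidHom.noncommCoprod (dualPairInl σ HV HW) (dualPairInr σ HV HW)
        (commute_dualPairInl_dualPairInr σ HV HW) = dualPair σ HV HW := by
  ext gg : 1
  rw [MonoidHom.noncommCoprod_apply, dualPairInl_apply, dualPairInr_apply, ← map_mul, Prod.mk_mul_mk, mul_one,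
    one_mul]

/-- `a` is continuous. [folklore] -/
theorem continuous_dualPairInl [TopologicalSpace S] [IsTopologicalRing S] (σ : S →+* S) (HV : Matrix n n S)
    (HW : Matrix m m S) : Continuous (dualPairInl σ HV HW) :=
  (continuous_dualPair σ HV HW).comp (continuous_id.prodMk continuous_const)

/-- `b` is continuous. [folklore] -/
theorem continuous_dualPairInr [TopologicalSpace S] [IsTopologicalRing S] (σ : S →+* S) (HV : Matrix n n S)
    (HW : Matrix m m S) : Continuous (dualPairInr σ HV HW) :=
  (continuous_dualPair σ HV HW).comp (continuous_const.prodMk continuous_id)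

/-- `a` is injective (`m` nonempty). [folklore] -/
theorem dualPairInl_injective [Nonempty m] (σ : S →+* S) (HV : Matrix n n S) (HW : Matrix m m S) :
    Function.Injective (dualPairInl σ HV HW) :=
  dualPair_inl_injective σ HV HW

/-- **Functoriality of `g ⊗ g′` in the ring**: `GL(f)(g ⊗ g′) = GL(f) g ⊗ GL(f) g′` — on underlying invertible
matrices, for `f` intertwining `σ` and `σ′`. [folklore] -/
theorem coe_map_dualPair {S' : Type*} [CommRing S'] {σ : S →+* S} {σ' : S' →+* S'} (f : S →+* S')
    (hf : ∀ x, f (σ x) = σ' (f x)) (HV : Matrix n n S) (HW : Matrix m m S)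
    (gg : unitaryGroupOfForm σ HV × unitaryGroupOfForm σ HW) :
    ((unitaryGroupOfFormMap f hf (HV ⊗ₖ HW) (dualPair σ HV HW gg) : unitaryGroupOfForm σ' ((HV ⊗ₖ HW).map f)) :
        GL (n × m) S') =
      (dualPair σ' (HV.map f) (HW.map f) (unitaryGroupOfFormMap f hf HV gg.1, unitaryGroupOfFormMap f hf HW gg.2) :
        GL (n × m) S') :=
  Units.ext (by
    simp only [coe_unitaryGroupOfFormMap, coe_dualPair]
    exact (kronecker_map_map f _ _).symm)

variable {φ : R →+* S} {Ψ : (R × R) ≃+ S} {δ : S} {d : R}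

/-- **`G₁ = U(σ, H_V ⊗ₖ H_W) →* Sp(alt (polar β_{T_V ⊗ T_W}))`** (`H_• = T_• ⊗ 1`, `T_•` symmetric): the big unitary
group of the dual pair in the symplectic group of `Res (V ⊗ W)`. [cite: GelbartRogawski1991, §3.1 p. 454] -/
def IsQuadraticCoordinates.pairToSymplectic (h : IsQuadraticCoordinates φ Ψ δ d) {TV : Matrix n n R}
    {TW : Matrix m m R} (hV : TV.IsSymm) (hW : TW.IsSymm) {σ : S →+* S} (hσφ : ∀ a, σ (φ a) = φ a)
    (hσδ : σ δ = -δ) {HV : Matrix n n S} {HW : Matrix m m S} (hHV : HV = TV.map φ) (hHW : HW = TW.map φ) :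
    unitaryGroupOfForm σ (HV ⊗ₖ HW) →* symplecticGroup (polar (Matrix.toLinearMap₂' R (TV ⊗ₖ TW))) :=
  h.toSymplectic (n × m) (isSymm_kronecker hV hW) hσφ hσδ
    (show HV ⊗ₖ HW = (TV ⊗ₖ TW).map φ by rw [hHV, hHW, kronecker_map_map])

/-- `pairToSymplectic ∘ dualPair = dualPairToSymplectic` (definitional). [folklore] -/
theorem IsQuadraticCoordinates.pairToSymplectic_comp_dualPair (h : IsQuadraticCoordinates φ Ψ δ d)
    {TV : Matrix n n R} {TW : Matrix m m R} (hV : TV.IsSymm) (hW : TW.IsSymm) {σ : S →+* S}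
    (hσφ : ∀ a, σ (φ a) = φ a) (hσδ : σ δ = -δ) {HV : Matrix n n S} {HW : Matrix m m S} (hHV : HV = TV.map φ)
    (hHW : HW = TW.map φ) :
    (h.pairToSymplectic hV hW hσφ hσδ hHV hHW).comp (dualPair σ HV HW) = h.dualPairToSymplectic hV hW hσφ hσδ hHV hHW :=
  rfl

/-- `pairToSymplectic` is injective. [folklore] -/
theorem IsQuadraticCoordinates.pairToSymplectic_injective (h : IsQuadraticCoordinates φ Ψ δ d)
    {TV : Matrix n n R} {TW : Matrix m m R} (hV : TV.IsSymm) (hW : TW.IsSymm) {σ : S →+* S}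
    (hσφ : ∀ a, σ (φ a) = φ a) (hσδ : σ δ = -δ) {HV : Matrix n n S} {HW : Matrix m m S} (hHV : HV = TV.map φ)
    (hHW : HW = TW.map φ) : Function.Injective (h.pairToSymplectic hV hW hσφ hσδ hHV hHW) :=
  h.toSymplectic_injective (n × m) _ hσφ hσδ _

end Generic

/-! ## 2. Number fields: `G₁(𝔸_F)`, `G₁(F)`, the inclusions and `G₁(𝔸_F) → Sp_𝔸(𝕎)` -/

section Adelic

variable (F E : Type) [Field F] [NumberField F] [Field E] [NumberField E] [Algebra F E]
variable (c : E ≃ₐ[F] E) (N M : ℕ) (JV : Matrix (Fin N) (Fin N) E) (JW : Matrix (Fin M) (Fin M) E)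

/-- **`G₁(𝔸_F) = U(J_V ⊗ J_W)(𝔸_F) ≤ GL_{N M}(𝔸_E)`** (index `Fin N × Fin M`), the adelic points of the big unitary
group of the dual pair. [cite: GelbartRogawski1991, §3.2 p. 457] -/
def adelicPair : Subgroup (GL (Fin N × Fin M) (AdeleRing (𝓞 E) E)) :=
  unitaryGroupOfForm (conjAdele F E c) (adelicForm E N JV ⊗ₖ adelicForm E M JW)

omit [NumberField F] in
/-- membership: `(c ⊗ 1)(g)ᵀ (J_V ⊗ J_W ⊗ 1) g = J_V ⊗ J_W ⊗ 1`. [folklore] -/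
theorem mem_adelicPair_iff (g : GL (Fin N × Fin M) (AdeleRing (𝓞 E) E)) :
    g ∈ adelicPair F E c N M JV JW ↔
      ((g : Matrix (Fin N × Fin M) (Fin N × Fin M) (AdeleRing (𝓞 E) E)).map (conjAdele F E c))ᵀ *
          (adelicForm E N JV ⊗ₖ adelicForm E M JW) * (g : Matrix (Fin N × Fin M) (Fin N × Fin M) (AdeleRing (𝓞 E) E)) =
        adelicForm E N JV ⊗ₖ adelicForm E M JW :=
  mem_unitaryGroupOfForm_iff

/-- **`a : U(J_V)(𝔸_F) →* G₁(𝔸_F)`, `g ↦ g ⊗ 1`.** [cite: GelbartRogawski1991, §3.2 p. 457] -/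
def adelicInl : adelic F E c N JV →* adelicPair F E c N M JV JW :=
  dualPairInl (conjAdele F E c) (adelicForm E N JV) (adelicForm E M JW)

/-- **`b : U(J_W)(𝔸_F) →* G₁(𝔸_F)`, `g′ ↦ 1 ⊗ g′`.** [cite: GelbartRogawski1991, §3.2 p. 457] -/
def adelicInr : adelic F E c M JW →* adelicPair F E c N M JV JW :=
  dualPairInr (conjAdele F E c) (adelicForm E N JV) (adelicForm E M JW)

omit [NumberField F] in
/-- underlying matrix of `a g`: `g ⊗ₖ 1`. [folklore] -/
@[simp] theorem coe_adelicInl (g : adelic F E c N JV) :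
    (((adelicInl F E c N M JV JW g : adelicPair F E c N M JV JW) : GL (Fin N × Fin M) (AdeleRing (𝓞 E) E)) :
        Matrix (Fin N × Fin M) (Fin N × Fin M) (AdeleRing (𝓞 E) E)) =
      ((g : GL (Fin N) (AdeleRing (𝓞 E) E)) : Matrix (Fin N) (Fin N) (AdeleRing (𝓞 E) E)) ⊗ₖ
        (1 : Matrix (Fin M) (Fin M) (AdeleRing (𝓞 E) E)) :=
  rfl

omit [NumberField F] in
/-- underlying matrix of `b g′`: `1 ⊗ₖ g′`. [folklore] -/
@[simp] theorem coe_adelicInr (g' : adelic F E c M JW) :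
    (((adelicInr F E c N M JV JW g' : adelicPair F E c N M JV JW) : GL (Fin N × Fin M) (AdeleRing (𝓞 E) E)) :
        Matrix (Fin N × Fin M) (Fin N × Fin M) (AdeleRing (𝓞 E) E)) =
      (1 : Matrix (Fin N) (Fin N) (AdeleRing (𝓞 E) E)) ⊗ₖ
        ((g' : GL (Fin M) (AdeleRing (𝓞 E) E)) : Matrix (Fin M) (Fin M) (AdeleRing (𝓞 E) E)) :=
  rfl

omit [NumberField F] in
/-- **`a(g)` and `b(g′)` commute** (the hypothesis `hab` of `SplittingDatum.IsCompatible.pair`). [folklore] -/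
theorem commute_adelicInl_adelicInr (g : adelic F E c N JV) (g' : adelic F E c M JW) :
    Commute (adelicInl F E c N M JV JW g) (adelicInr F E c N M JV JW g') :=
  commute_dualPairInl_dualPairInr _ _ _ g g'

omit [NumberField F] in
/-- `(g, g′) ↦ a(g) b(g′)` is the adelic dual pair map. [folklore] -/
theorem noncommCoprod_adelicInl_adelicInr :
    MonoidHom.noncommCoprod (adelicInl F E c N M JV JW) (adelicInr F E c N M JV JW)
        (commute_adelicInl_adelicInr F E c N M JV JW) =
      dualPair (conjAdele F E c) (adelicForm E N JV) (adelicForm E M JW) :=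
  noncommCoprod_dualPairInl_dualPairInr _ _ _

omit [NumberField F] in
/-- **`a` is continuous** (hypothesis `hac` of `SplittingDatum.continuous_pair`). [folklore] -/
theorem continuous_adelicInl : Continuous (adelicInl F E c N M JV JW) :=
  continuous_dualPairInl _ _ _

omit [NumberField F] in
/-- **`b` is continuous** (hypothesis `hbc`). [folklore] -/
theorem continuous_adelicInr : Continuous (adelicInr F E c N M JV JW) :=
  continuous_dualPairInr _ _ _

omit [NumberField F] in
/-- `a` is injective for `M ≠ 0`. [folklore] -/
theorem adelicInl_injective [NeZero M] : Function.Injective (adelicInl F E c N M JV JW) :=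
  dualPairInl_injective _ _ _

/-- **`G₁(F) = U(J_V ⊗ J_W)(F) ≤ GL_{N M}(E)`.** [cite: GelbartRogawski1991, §3.2 p. 457] -/
def rationalPair : Subgroup (GL (Fin N × Fin M) E) :=
  unitaryGroupOfForm (c : E →+* E) (JV ⊗ₖ JW)

/-- `a_F : U(J_V)(F) →* G₁(F)`. [folklore] -/
def rationalInl : rational F E c N JV →* rationalPair F E c N M JV JW :=
  dualPairInl (c : E →+* E) JV JW

/-- `b_F : U(J_W)(F) →* G₁(F)`. [folklore] -/
def rationalInr : rational F E c M JW →* rationalPair F E c N M JV JW :=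
  dualPairInr (c : E →+* E) JV JW

omit [NumberField F] in
/-- `(J_V ⊗ J_W) ⊗ 1 = (J_V ⊗ 1) ⊗ₖ (J_W ⊗ 1)` as subgroups: `U(c ⊗ 1, (J_V ⊗ₖ J_W) ⊗ 1) = G₁(𝔸_F)`. [folklore] -/
theorem unitaryGroupOfForm_kronecker_map :
    unitaryGroupOfForm (conjAdele F E c) ((JV ⊗ₖ JW).map (algebraMap E (AdeleRing (𝓞 E) E))) =
      adelicPair F E c N M JV JW := by
  rw [adelicPair, ← kronecker_map_map]
  rfl

/-- **the diagonal embedding `G₁(F) →* G₁(𝔸_F)`** (restriction of `GL_{NM}(E) → GL_{NM}(𝔸_E)`). [folklore] -/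
def rationalPairToAdelic : rationalPair F E c N M JV JW →* adelicPair F E c N M JV JW :=
  (MulEquiv.subgroupCongr (unitaryGroupOfForm_kronecker_map F E c N M JV JW)).toMonoidHom.comp
    (unitaryGroupOfFormMap (algebraMap E (AdeleRing (𝓞 E) E)) (algebraMap_conj F E c) (JV ⊗ₖ JW))

omit [NumberField F] in
/-- underlying matrix of `rationalPairToAdelic γ`: `γ ⊗ 1` entrywise. [folklore] -/
@[simp] theorem coe_rationalPairToAdelic (γ : rationalPair F E c N M JV JW) :
    (((rationalPairToAdelic F E c N M JV JW γ : adelicPair F E c N M JV JW) :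
        GL (Fin N × Fin M) (AdeleRing (𝓞 E) E)) : Matrix (Fin N × Fin M) (Fin N × Fin M) (AdeleRing (𝓞 E) E)) =
      ((γ : GL (Fin N × Fin M) E) : Matrix (Fin N × Fin M) (Fin N × Fin M) E).map (algebraMap E (AdeleRing (𝓞 E) E)) :=
  rfl

omit [NumberField F] in
/-- `rationalPairToAdelic` is injective. [folklore] -/
theorem rationalPairToAdelic_injective : Function.Injective (rationalPairToAdelic F E c N M JV JW) := by
  intro γ γ' h
  have hm := congrArg (fun u : adelicPair F E c N M JV JW =>
    ((u : GL (Fin N × Fin M) (AdeleRing (𝓞 E) E)) : Matrix (Fin N × Fin M) (Fin N × Fin M) (AdeleRing (𝓞 E) E))) h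
  simp only [coe_rationalPairToAdelic] at hm
  refine Subtype.ext (Units.ext (Matrix.ext fun i j => ?_))
  exact AdeleRing.algebraMap_injective (𝓞 E) E (congrFun (congrFun hm i) j)

omit [NumberField F] in
/-- **`a ∘ (F ↪ 𝔸) = (F ↪ 𝔸) ∘ a_F`**: `a(toAdelic γ) = rationalPairToAdelic (a_F γ)`. [folklore] -/
theorem adelicInl_toAdelic (γ : rational F E c N JV) :
    adelicInl F E c N M JV JW (toAdelic F E c N JV γ) = rationalPairToAdelic F E c N M JV JW (rationalInl F E c N M JV JW γ) := by
  refine Subtype.ext (Units.ext ?_)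
  rw [coe_adelicInl, coe_rationalPairToAdelic]
  show ((γ : GL (Fin N) E) : Matrix (Fin N) (Fin N) E).map (algebraMap E (AdeleRing (𝓞 E) E)) ⊗ₖ
      (1 : Matrix (Fin M) (Fin M) (AdeleRing (𝓞 E) E)) =
    (((γ : GL (Fin N) E) : Matrix (Fin N) (Fin N) E) ⊗ₖ (1 : Matrix (Fin M) (Fin M) E)).map
      (algebraMap E (AdeleRing (𝓞 E) E))
  rw [← kronecker_map_map, Matrix.map_one (algebraMap E _) (map_zero _) (map_one _)]

omit [NumberField F] in
/-- **`b ∘ (F ↪ 𝔸) = (F ↪ 𝔸) ∘ b_F`.** [folklore] -/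
theorem adelicInr_toAdelic (γ : rational F E c M JW) :
    adelicInr F E c N M JV JW (toAdelic F E c M JW γ) = rationalPairToAdelic F E c N M JV JW (rationalInr F E c N M JV JW γ) := by
  refine Subtype.ext (Units.ext ?_)
  rw [coe_adelicInr, coe_rationalPairToAdelic]
  show (1 : Matrix (Fin N) (Fin N) (AdeleRing (𝓞 E) E)) ⊗ₖ
      ((γ : GL (Fin M) E) : Matrix (Fin M) (Fin M) E).map (algebraMap E (AdeleRing (𝓞 E) E)) =
    ((1 : Matrix (Fin N) (Fin N) E) ⊗ₖ ((γ : GL (Fin M) E) : Matrix (Fin M) (Fin M) E)).map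
      (algebraMap E (AdeleRing (𝓞 E) E))
  rw [← kronecker_map_map, Matrix.map_one (algebraMap E _) (map_zero _) (map_one _)]

omit [NumberField F] in
/-- hence `a(G_U(F)) ⊆ G₁(F)` inside `G₁(𝔸_F)` — the hypothesis `ha` of `SplittingDatum.IsCompatible.pair` with
`ratPts := (rationalPairToAdelic …).range`. [folklore] -/
theorem adelicInl_toAdelic_mem_range (γ : rational F E c N JV) :
    adelicInl F E c N M JV JW (toAdelic F E c N JV γ) ∈ (rationalPairToAdelic F E c N M JV JW).range :=
  ⟨rationalInl F E c N M JV JW γ, (adelicInl_toAdelic F E c N M JV JW γ).symm⟩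

omit [NumberField F] in
/-- and `b(G(F)) ⊆ G₁(F)` — the hypothesis `hb`. [folklore] -/
theorem adelicInr_toAdelic_mem_range (γ : rational F E c M JW) :
    adelicInr F E c N M JV JW (toAdelic F E c M JW γ) ∈ (rationalPairToAdelic F E c N M JV JW).range :=
  ⟨rationalInr F E c N M JV JW γ, (adelicInr_toAdelic F E c N M JV JW γ).symm⟩

variable {JV JW}

/-- **`toSp : G₁(𝔸_F) →* Sp_𝔸(𝕎)`**, `𝕎 = Res_{E/F}(V ⊗ W) ⊗ 𝔸_F`, for `J_V = T_V ⊗ 1`, `J_W = T_W ⊗ 1` with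
`T_V, T_W` symmetric over `F` — the `toSp` of the dual-pair splitting datum. [cite: GelbartRogawski1991, §3.1 p. 454] -/
def adelicPairToSymplectic [Algebra.IsQuadraticExtension F E] {δ : E} (hcδ : c δ = -δ) (hδ : δ ≠ 0) {d : F}
    (hd : δ * δ = algebraMap F E d) {TV : Matrix (Fin N) (Fin N) F} {TW : Matrix (Fin M) (Fin M) F}
    (hV : TV.IsSymm) (hW : TW.IsSymm) (hJV : JV = TV.map (algebraMap F E)) (hJW : JW = TW.map (algebraMap F E)) :
    adelicPair F E c N M JV JW →*
      symplecticGroup (polar (Matrix.toLinearMap₂' (AdeleRing (𝓞 F) F)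
        (TV.map (algebraMap F (AdeleRing (𝓞 F) F)) ⊗ₖ TW.map (algebraMap F (AdeleRing (𝓞 F) F))))) :=
  (isQuadraticCoordinates_adele E c hcδ hδ hd).pairToSymplectic (hV.map _) (hW.map _)
    (σ := conjAdele F E c) (fun a => by rw [conjAdele_apply, AdeleRing.smul_baseChange])
    (by rw [← algebraMap_conj, RingHom.coe_coe, hcδ, map_neg]) (adelicForm_eq_map_map E N TV hJV)
    (adelicForm_eq_map_map E M TW hJW)

/-- **`toSp ∘ (a·b) = adelicDualPairToSymplectic`** (definitional): the pair embedding of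
`UnitaryGroupSymplecticCarriers` factors through `G₁(𝔸_F)`. [folklore] -/
theorem adelicPairToSymplectic_comp_dualPair [Algebra.IsQuadraticExtension F E] {δ : E} (hcδ : c δ = -δ)
    (hδ : δ ≠ 0) {d : F} (hd : δ * δ = algebraMap F E d) {TV : Matrix (Fin N) (Fin N) F}
    {TW : Matrix (Fin M) (Fin M) F} (hV : TV.IsSymm) (hW : TW.IsSymm) (hJV : JV = TV.map (algebraMap F E))
    (hJW : JW = TW.map (algebraMap F E)) :
    (adelicPairToSymplectic F E c N M hcδ hδ hd hV hW hJV hJW).comp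
        (dualPair (conjAdele F E c) (adelicForm E N JV) (adelicForm E M JW)) =
      adelicDualPairToSymplectic F E c N M hcδ hδ hd hV hW hJV hJW :=
  rfl

/-- `toSp` is injective. [folklore] -/
theorem adelicPairToSymplectic_injective [Algebra.IsQuadraticExtension F E] {δ : E} (hcδ : c δ = -δ)
    (hδ : δ ≠ 0) {d : F} (hd : δ * δ = algebraMap F E d) {TV : Matrix (Fin N) (Fin N) F}
    {TW : Matrix (Fin M) (Fin M) F} (hV : TV.IsSymm) (hW : TW.IsSymm) (hJV : JV = TV.map (algebraMap F E))
    (hJW : JW = TW.map (algebraMap F E)) :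
    Function.Injective (adelicPairToSymplectic F E c N M hcδ hδ hd hV hW hJV hJW) :=
  (isQuadraticCoordinates_adele E c hcδ hδ hd).pairToSymplectic_injective _ _ _ _ _ _

/-- **`toSp(γ)` has `F`-rational blocks for `γ ∈ G₁(F)`**: with `γ = γ₁ + γ₂ δ` (`γ₁ = re ∘ γ`, `γ₂ = im ∘ γ` entrywise
over `F`, index `Fin N × Fin M`), `adelicPairToSymplectic (rationalPairToAdelic γ) (a, b) = ((γ₁ ⊗ 1) a + d (γ₂ ⊗ 1) b,
(γ₂ ⊗ 1) a + (γ₁ ⊗ 1) b)` — so `toSp(G₁(F)) ⊂ Sp_F(𝕎)`, the field `toSp_mem_spRat` of the dual-pair splitting datum.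
[cite: GelbartRogawski1991, §3.1 p. 455] -/
theorem adelicPairToSymplectic_rationalPairToAdelic_apply [Algebra.IsQuadraticExtension F E] {δ : E}
    (hcδ : c δ = -δ) (hδ : δ ≠ 0) {d : F} (hd : δ * δ = algebraMap F E d) {TV : Matrix (Fin N) (Fin N) F}
    {TW : Matrix (Fin M) (Fin M) F} (hV : TV.IsSymm) (hW : TW.IsSymm) (hJV : JV = TV.map (algebraMap F E))
    (hJW : JW = TW.map (algebraMap F E)) (γ : rationalPair F E c N M JV JW)
    (a b : Fin N × Fin M → AdeleRing (𝓞 F) F) :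
    (adelicPairToSymplectic F E c N M hcδ hδ hd hV hW hJV hJW (rationalPairToAdelic F E c N M JV JW γ)).1 (a, b) =
      ((((γ : GL (Fin N × Fin M) E) : Matrix (Fin N × Fin M) (Fin N × Fin M) E).map (QuadraticCoordinates.re
            (quadraticRatCoords E (not_mem_range_algebraMap_of_apply_eq_neg E c hcδ hδ)).toAddEquiv)).map
            (algebraMap F (AdeleRing (𝓞 F) F)) *ᵥ a +
          algebraMap F (AdeleRing (𝓞 F) F) d •
            ((((γ : GL (Fin N × Fin M) E) : Matrix (Fin N × Fin M) (Fin N × Fin M) E).map (QuadraticCoordinates.im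
              (quadraticRatCoords E (not_mem_range_algebraMap_of_apply_eq_neg E c hcδ hδ)).toAddEquiv)).map
              (algebraMap F (AdeleRing (𝓞 F) F)) *ᵥ b),
        (((γ : GL (Fin N × Fin M) E) : Matrix (Fin N × Fin M) (Fin N × Fin M) E).map (QuadraticCoordinates.im
            (quadraticRatCoords E (not_mem_range_algebraMap_of_apply_eq_neg E c hcδ hδ)).toAddEquiv)).map
            (algebraMap F (AdeleRing (𝓞 F) F)) *ᵥ a +
          (((γ : GL (Fin N × Fin M) E) : Matrix (Fin N × Fin M) (Fin N × Fin M) E).map (QuadraticCoordinates.re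
            (quadraticRatCoords E (not_mem_range_algebraMap_of_apply_eq_neg E c hcδ hδ)).toAddEquiv)).map
            (algebraMap F (AdeleRing (𝓞 F) F)) *ᵥ b) := by
  have hre : ∀ P : Matrix (Fin N × Fin M) (Fin N × Fin M) E,
      (P.map (algebraMap E (AdeleRing (𝓞 E) E))).map
          (QuadraticCoordinates.re (quadraticAdeleEquiv F E c hcδ hδ).toAddEquiv) =
        (P.map (QuadraticCoordinates.re
          (quadraticRatCoords E (not_mem_range_algebraMap_of_apply_eq_neg E c hcδ hδ)).toAddEquiv)).map
          (algebraMap F (AdeleRing (𝓞 F) F)) := fun P => by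
    rw [Matrix.map_map, Matrix.map_map]
    exact congrArg P.map (funext (adele_re_algebraMap F E c hcδ hδ hd))
  have him : ∀ P : Matrix (Fin N × Fin M) (Fin N × Fin M) E,
      (P.map (algebraMap E (AdeleRing (𝓞 E) E))).map
          (QuadraticCoordinates.im (quadraticAdeleEquiv F E c hcδ hδ).toAddEquiv) =
        (P.map (QuadraticCoordinates.im
          (quadraticRatCoords E (not_mem_range_algebraMap_of_apply_eq_neg E c hcδ hδ)).toAddEquiv)).map
          (algebraMap F (AdeleRing (𝓞 F) F)) := fun P => by
    rw [Matrix.map_map, Matrix.map_map]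
    exact congrArg P.map (funext (adele_im_algebraMap F E c hcδ hδ hd))
  rw [← hre, ← him]
  exact (isQuadraticCoordinates_adele E c hcδ hδ hd).resAut_apply_mk (Fin N × Fin M) _ a b

end Adelic

end UnitaryGroup

end Literature.NumberTheory.Automorphic

end
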